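import Summits.QuantumFields.YangMills.Theorems.BalabanUVNodesK2NamedJetsLimit

/-!
# idea-7 (lens «inversion») — ANSWER TO plan g83 (q-K2-1) ∕ trigger (β2): «is `RunRemAt` at the record provable UNIFORMLY over
`KAdm := {κ | ∀ F, ∃ A, OneLoopDrift (stepBal 2 F.L) A (beta0OfJs F (κ F.L))}`?» — RUN 2ᴼ BACKWARDS THROUGH THE ANCHOR.

Crux K2⁷ `stmt-QuantumFields-20543` `Summit.QuantumFields.YangMills.Theses.BalabanUVNodes.EndpointGivenBR13SepCoPH` (route rev 25; skeleton of record v6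
`5a75a2378c79b303`).  Seat `ym-nodeO-idea-7` GEN 9 (planner-ym-nodeO-idea-7-g9-0), 2026-08-28.  A CRUX WORKFILE (sketch), not a Theorems proposal; sorry-free.

THE POINT (kernel-checked below, every ingredient a tree name).  `RunRemAt F κ θ hP c` (DEF-1 p596574 :175) reads the colour datum `κ` ONLY through the named
sequence `beta0OfJs F κ`, and its ANCHOR conjunct makes that sequence UNIQUE per admissible record (`beta0OfJs_eq_of_runRemAt_adm`, p596574 :206).  Plan g83's
class `KAdm` (WORDS-3, pub-ymgap INBOX l.29515) constrains only the LIMIT of the sequence (`drift_iff_lim_eq`, D1-W1 p607079 :85) and is closed under re-choosing the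
datum at one block size (`KAdm.update`).  Hence, at ANY tuple carrying v6's prefix (unity guard, admissibility, (B), window):

* `uniformKAdm_iff_pin_and_relThin` — **2ᴼ over `KAdm` ⟺ (the run letter at ONE pin `κ⋆ ∈ KAdm`) ∧ (every drift-variety member at that block size has THE PIN'S NAMED
  SEQUENCE at every prefixed admissible tuple)**.  So (β2) does NOT avoid naming `κ⋆`: by anchor uniqueness 2ᴼ names the pin's sequence, and (β2) = (β1) + a θ-free
  identity family «the drift variety is SEQUENCE-THIN» (`RelSeqThin`).
* `not_uniformKAdm_of_two_sequences` — **THE CHEAP KILL of (β2)**: one `κ⋆ ∈ KAdm`, ONE variety member `c` at block size `F.L` with `beta0OfJs F c ≠ beta0OfJs F (κ⋆ F.L)`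
  (a finite-`j` statement about two named sequences with the SAME limit), and ONE inhabitant of v6's prefix at `F` ⟹ `¬ 2ᴼ[KAdm]`.  Equivalently
  `false_of_beta2Pair`: the proposed v7 pair {1ᴰ `∃ κ, KAdm κ`, 2ᴼ} together with such a pair of sequences and a prefix inhabitant (= what K0⁷ ∧ K1⁷ are FOR) is
  CONTRADICTORY — a cut dead at birth unless the variety is sequence-thin.
* `uniformFibre_of_pin` — the honest uniform class is FREE: the run letter at a pin `κ⋆` is automatically uniform over the sequence-fibre
  `Fibre κ⋆ := {κ | ∀ F, beta0OfJs F (κ F.L) = beta0OfJs F (κ⋆ F.L)}` (`runRemAt_congr`), and `Fibre κ⋆ ⊆ KAdm` when `κ⋆ ∈ KAdm`.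

READING FOR THE PLAN.  2ᴼ over the full `KAdm` is NOT NODE O's honest wall: it is the pinned run letter PLUS a β-side rigidity («all colour data with drifting numbers have
identical numbers at every step j»), decidable member-by-member by the (D1) desks and generically FALSE (two stencils with different finite-volume j-tails and the same
limit break it; cheapest instance: the position-table directions, along which limit and sequence are affine — a 2 × 2 determinant of table-response numbers at j = 0, 1).
So: (β2) ⟹ (β1) up to sequence-equivalence; cut (β1) (a κ⋆ COMMIT), or cut (β2) only together with a certified `RelSeqThin` — never bare.

HONEST: [folklore] bookkeeping over tree letters; nothing of Bałaban asserted; no coefficient computed; (D1) not discharged at any κ; no stub proved; K2⁷ OPEN; the route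
closes only the conditional finite-𝕋⁴ rung `BalabanLadder.UV`; the Clay YM mass gap is NOT proved by any of this.
-/

namespace Summit.QuantumFields.YangMills.Cruxes.EndpointGivenBR13SepCoPH.Idea7UniformThin

open Literature.MathematicalPhysics.QuantumFieldTheory.Balaban1983to89
open Literature.MathematicalPhysics.QuantumFieldTheory.Balaban1983to89.T4Continuum (T4Family)
open Literature.MathematicalPhysics.QuantumFieldTheory.Balaban1983to89.Beta.Drift (OneLoopDrift)
open Literature.MathematicalPhysics.QuantumFieldTheory.Balaban1983to89.Beta.RateCertificate (CauchyRate)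
open Summit.QuantumFields.YangMills.Theorems.BalabanUVNodesK2JsOfRecord (StepColourData beta0OfJs)
open Summit.QuantumFields.YangMills.Theorems.BalabanUVNodesK2NamedJetsRunRemAt (RunRemAt beta0OfJs_eq_of_runRemAt_adm)
open Summit.QuantumFields.YangMills.Theorems.BalabanUVNodesK2V6Defs (Window13 RunRemAtSomeJets D1AtAnchoredJets EndpointGivenBR13SepCoPH_of_pin)
open Summit.QuantumFields.YangMills.Theorems.BalabanUVNodesK2NamedJetsLimit (drift_iff_lim_eq)

/-! ## §0 The letters of (q-K2-1) -/

/-- plan g83 (β2)'s class: block-size-indexed colour data whose named numbers DRIFT with slope `stepBal 2 F.L` at every family. [folklore] -/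
def KAdm (κ : ℕ → StepColourData) : Prop :=
  ∀ F : T4Family, ∃ A : ℝ, OneLoopDrift (B12Normalization.stepBal 2 F.L) A (beta0OfJs F (κ F.L))

/-- the pinned run letter at `κ⋆` under v6's full prefix (= hypothesis `hRun` of DEF-1's `EndpointGivenBR13SepCoPH_of_pin`, VERBATIM). [folklore] -/
def RunAtPin (κ : ℕ → StepColourData) : Prop :=
  ∀ (F : T4Family) (θ : Node00.Stage13HParams F 2) (hP : θ.Provisos₁₃SepCoPH F 2), (θ.ZhUnity F 2 ∧ θ.SlotsNondegenerate₁₃ F 2) → θ.Admissible F 2 →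
    B16.EndStatementBPrinted (Node00.datumOfRecord₁₃SepCoPH F 2 θ hP).C → Window13 F θ hP → RunRemAt F (κ F.L) θ hP θ.cβ

/-- 2ᴼ over a class `K` of block-size-indexed colour data: the run letter at EVERY member, under v6's full prefix. [folklore] -/
def UniformOver (K : (ℕ → StepColourData) → Prop) : Prop :=
  ∀ κ : ℕ → StepColourData, K κ → RunAtPin κ

/-- `c` lies on the drift variety at block size `L₀` (at every family of that block size — `beta0OfJs F c` is read family-wise, as the tree types it). [folklore] -/
def OnVarietyAt (L₀ : ℕ) (c : StepColourData) : Prop :=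
  ∀ F : T4Family, F.L = L₀ → ∃ A : ℝ, OneLoopDrift (B12Normalization.stepBal 2 F.L) A (beta0OfJs F c)

/-- the sequence-fibre of a pin: colour data with THE PIN'S named sequence at every family. [folklore] -/
def Fibre (κ₀ κ : ℕ → StepColourData) : Prop :=
  ∀ F : T4Family, beta0OfJs F (κ F.L) = beta0OfJs F (κ₀ F.L)

/-- relative sequence-thinness of the drift variety seen from the pin `κ⋆`, AT the tuples carrying v6's prefix: every variety member at block size `F.L` has the pin's
named SEQUENCE at `F`.  A θ-free identity family once a prefix inhabitant exists at `F`; vacuous where the prefix is empty. [folklore] -/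
def RelSeqThin (κ₀ : ℕ → StepColourData) : Prop :=
  ∀ (F : T4Family) (θ : Node00.Stage13HParams F 2) (hP : θ.Provisos₁₃SepCoPH F 2), (θ.ZhUnity F 2 ∧ θ.SlotsNondegenerate₁₃ F 2) → θ.Admissible F 2 →
    B16.EndStatementBPrinted (Node00.datumOfRecord₁₃SepCoPH F 2 θ hP).C → Window13 F θ hP →
    ∀ c : StepColourData, OnVarietyAt F.L c → beta0OfJs F c = beta0OfJs F (κ₀ F.L)

/-! ## §1 Three structural facts: the run letter reads κ only through the sequence; `KAdm` reads only the limit and is closed under one-block updates -/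

/-- `RunRemAt` depends on the colour datum only through its named sequence. [folklore] -/
theorem runRemAt_congr {F : T4Family} {κ κ' : StepColourData} {θ : Node00.Stage13HParams F 2} {hP : θ.Provisos₁₃SepCoPH F 2} {c : ℝ}
    (h : beta0OfJs F κ = beta0OfJs F κ') : RunRemAt F κ θ hP c ↔ RunRemAt F κ' θ hP c := by
  unfold RunRemAt
  rw [h]

/-- a member of `KAdm` is on the variety at each of its block sizes. [folklore] -/
theorem onVarietyAt_of_kAdm {κ : ℕ → StepColourData} (hκ : KAdm κ) (L₀ : ℕ) : OnVarietyAt L₀ (κ L₀) := by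
  intro F hF
  rw [← hF]
  exact hκ F

/-- `KAdm` is closed under re-choosing the datum at ONE block size by any variety member there. [folklore] -/
theorem KAdm.update {κ : ℕ → StepColourData} (hκ : KAdm κ) {L₀ : ℕ} {c : StepColourData} (hc : OnVarietyAt L₀ c) :
    KAdm (Function.update κ L₀ c) := by
  intro F
  rw [Function.update_apply]
  by_cases h : F.L = L₀
  · rw [if_pos h]; exact hc F h
  · rw [if_neg h]; exact hκ F

/-- the fibre of a `KAdm` pin lies inside `KAdm` (drift is a property of the sequence). [folklore] -/
theorem kAdm_of_fibre {κ₀ κ : ℕ → StepColourData} (h₀ : KAdm κ₀) (h : Fibre κ₀ κ) : KAdm κ := by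
  intro F
  rw [h F]
  exact h₀ F

/-- `KAdm κ` in limit letters: `∀ F, CauchyRate.lim (beta0OfJs F (κ F.L)) = stepBal 2 F.L` (D1-W1's `drift_iff_lim_eq` BY NAME). [folklore] -/
theorem kAdm_iff_lim (κ : ℕ → StepColourData) :
    KAdm κ ↔ ∀ F : T4Family, CauchyRate.lim (beta0OfJs F (κ F.L)) = B12Normalization.stepBal 2 F.L :=
  forall_congr' fun F => drift_iff_lim_eq F (κ F.L) 2

/-! ## §2 2ᴼ RUN BACKWARDS: uniformity over `KAdm` forces the variety onto ONE sequence -/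

/-- under 2ᴼ[KAdm] with one member `κ⋆`, EVERY variety member at block size `F.L` carries the run letter at every prefixed admissible tuple over `F` (update the pin at `F.L`).
[folklore] -/
theorem runRemAt_onVariety_of_uniformKAdm (hU : UniformOver KAdm) {κ₀ : ℕ → StepColourData} (h₀ : KAdm κ₀)
    (F : T4Family) (θ : Node00.Stage13HParams F 2) (hP : θ.Provisos₁₃SepCoPH F 2) (hUθ : θ.ZhUnity F 2 ∧ θ.SlotsNondegenerate₁₃ F 2) (hθ : θ.Admissible F 2)
    (hB : B16.EndStatementBPrinted (Node00.datumOfRecord₁₃SepCoPH F 2 θ hP).C) (hW : Window13 F θ hP)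
    {c : StepColourData} (hc : OnVarietyAt F.L c) : RunRemAt F c θ hP θ.cβ := by
  have h := hU _ (h₀.update hc) F θ hP hUθ hθ hB hW
  rwa [Function.update_apply, if_pos rfl] at h

/-- **★ 2ᴼ[KAdm] ⟹ RELATIVE SEQUENCE-THINNESS**: with one member `κ⋆ ∈ KAdm`, uniformity forces every variety member to have THE PIN'S named sequence at every prefixed
admissible tuple (anchor uniqueness `beta0OfJs_eq_of_runRemAt_adm` BY NAME). [folklore] -/
theorem relSeqThin_of_uniformKAdm (hU : UniformOver KAdm) {κ₀ : ℕ → StepColourData} (h₀ : KAdm κ₀) : RelSeqThin κ₀ := by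
  intro F θ hP hUθ hθ hB hW c hc
  exact beta0OfJs_eq_of_runRemAt_adm F c (κ₀ F.L) θ hP hθ (runRemAt_onVariety_of_uniformKAdm hU h₀ F θ hP hUθ hθ hB hW hc)
    (hU κ₀ h₀ F θ hP hUθ hθ hB hW)

/-- … and any two variety members have the SAME named sequence at such a tuple. [folklore] -/
theorem beta0OfJs_eq_onVariety_of_uniformKAdm (hU : UniformOver KAdm) {κ₀ : ℕ → StepColourData} (h₀ : KAdm κ₀)
    (F : T4Family) (θ : Node00.Stage13HParams F 2) (hP : θ.Provisos₁₃SepCoPH F 2) (hUθ : θ.ZhUnity F 2 ∧ θ.SlotsNondegenerate₁₃ F 2) (hθ : θ.Admissible F 2)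
    (hB : B16.EndStatementBPrinted (Node00.datumOfRecord₁₃SepCoPH F 2 θ hP).C) (hW : Window13 F θ hP)
    {c c' : StepColourData} (hc : OnVarietyAt F.L c) (hc' : OnVarietyAt F.L c') : beta0OfJs F c = beta0OfJs F c' :=
  (relSeqThin_of_uniformKAdm hU h₀ F θ hP hUθ hθ hB hW c hc).trans (relSeqThin_of_uniformKAdm hU h₀ F θ hP hUθ hθ hB hW c' hc').symm

/-- **★★ THE CHEAP KILL OF (β2)**: a `KAdm` member `κ⋆`, ONE variety member `c` at block size `F.L` whose named sequence differs from the pin's at `F` (same limit, different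
finite-`j` numbers), and ONE inhabitant of v6's prefix over `F` ⟹ 2ᴼ over `KAdm` is FALSE. [folklore] -/
theorem not_uniformKAdm_of_two_sequences {κ₀ : ℕ → StepColourData} (h₀ : KAdm κ₀)
    (F : T4Family) (θ : Node00.Stage13HParams F 2) (hP : θ.Provisos₁₃SepCoPH F 2) (hUθ : θ.ZhUnity F 2 ∧ θ.SlotsNondegenerate₁₃ F 2) (hθ : θ.Admissible F 2)
    (hB : B16.EndStatementBPrinted (Node00.datumOfRecord₁₃SepCoPH F 2 θ hP).C) (hW : Window13 F θ hP)
    {c : StepColourData} (hc : OnVarietyAt F.L c) (hne : beta0OfJs F c ≠ beta0OfJs F (κ₀ F.L)) : ¬ UniformOver KAdm :=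
  fun hU => hne (relSeqThin_of_uniformKAdm hU h₀ F θ hP hUθ hθ hB hW c hc)

/-- **the proposed v7 pair (β2) = {1ᴰ `∃ κ, KAdm κ`, 2ᴼ `UniformOver KAdm`} is CONTRADICTORY with (one prefix inhabitant over some `F`) + (two variety members at `F.L` with different
named sequences at `F`)** — i.e. with exactly what K0⁷ ∧ K1⁷ are meant to deliver plus one β-side non-degeneracy. [folklore] -/
theorem false_of_beta2Pair (h1D : ∃ κ, KAdm κ) (h2O : UniformOver KAdm)
    (hsep : ∃ (F : T4Family) (θ : Node00.Stage13HParams F 2) (hP : θ.Provisos₁₃SepCoPH F 2),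
      (θ.ZhUnity F 2 ∧ θ.SlotsNondegenerate₁₃ F 2) ∧ θ.Admissible F 2 ∧ B16.EndStatementBPrinted (Node00.datumOfRecord₁₃SepCoPH F 2 θ hP).C ∧ Window13 F θ hP ∧
      ∃ c c' : StepColourData, OnVarietyAt F.L c ∧ OnVarietyAt F.L c' ∧ beta0OfJs F c ≠ beta0OfJs F c') : False := by
  obtain ⟨κ₀, h₀⟩ := h1D
  obtain ⟨F, θ, hP, hUθ, hθ, hB, hW, c, c', hc, hc', hne⟩ := hsep
  exact hne (beta0OfJs_eq_onVariety_of_uniformKAdm h2O h₀ F θ hP hUθ hθ hB hW hc hc')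

/-! ## §3 The honest uniform class is FREE: the sequence-fibre of a pin; and 2ᴼ[KAdm] = pin + thinness exactly -/

/-- the run letter at a pin is uniform over the pin's sequence-fibre, for free (`runRemAt_congr`). [folklore] -/
theorem uniformFibre_of_pin {κ₀ : ℕ → StepColourData} (hRun : RunAtPin κ₀) : UniformOver (Fibre κ₀) :=
  fun _κ hκ F θ hP hUθ hθ hB hW => (runRemAt_congr (hκ F)).mpr (hRun F θ hP hUθ hθ hB hW)

/-- **★★ 2ᴼ OVER `KAdm` ⟺ (RUN LETTER AT ONE PIN `κ⋆ ∈ KAdm`) ∧ (RELATIVE SEQUENCE-THINNESS AT THE PIN)** — (β2) is (β1) plus a θ-free β-side identity family; it does not avoid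
naming the pin (anchor uniqueness names its sequence). [folklore] -/
theorem uniformKAdm_iff_pin_and_relThin {κ₀ : ℕ → StepColourData} (h₀ : KAdm κ₀) :
    UniformOver KAdm ↔ RunAtPin κ₀ ∧ RelSeqThin κ₀ := by
  refine ⟨fun hU => ⟨hU κ₀ h₀, relSeqThin_of_uniformKAdm hU h₀⟩, fun ⟨hRun, hthin⟩ κ hκ F θ hP hUθ hθ hB hW => ?_⟩
  have hseq : beta0OfJs F (κ F.L) = beta0OfJs F (κ₀ F.L) := hthin F θ hP hUθ hθ hB hW (κ F.L) (onVarietyAt_of_kAdm hκ F.L)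
  exact (runRemAt_congr hseq).mpr (hRun F θ hP hUθ hθ hB hW)

/-- … so the (β2) pair closes the crux decl BY NAME exactly as the (β1) pair does — through DEF-1's `EndpointGivenBR13SepCoPH_of_pin` at the 1ᴰ witness; uniformity beyond the
witness is never read. [folklore] -/
theorem EndpointGivenBR13SepCoPH_of_beta2Pair (h1D : ∃ κ, KAdm κ) (h2O : UniformOver KAdm) :
    Summit.QuantumFields.YangMills.Theses.BalabanUVNodes.EndpointGivenBR13SepCoPH := by
  obtain ⟨κ₀, h₀⟩ := h1D
  exact EndpointGivenBR13SepCoPH_of_pin κ₀ h₀ (h2O κ₀ h₀)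

/-- … and what 2ᴼ adds over the pinned letter is PRECISELY the thinness conjunct: given the pinned pair (β1) at `κ⋆`, `2ᴼ[KAdm] ⟺ RelSeqThin κ⋆`. [folklore] -/
theorem uniformKAdm_iff_relThin_of_pinnedPair {κ₀ : ℕ → StepColourData} (h₀ : KAdm κ₀) (hRun : RunAtPin κ₀) :
    UniformOver KAdm ↔ RelSeqThin κ₀ := by
  rw [uniformKAdm_iff_pin_and_relThin h₀]
  exact ⟨fun h => h.2, fun h => ⟨hRun, h⟩⟩

end Summit.QuantumFields.YangMills.Cruxes.EndpointGivenBR13SepCoPH.Idea7UniformThin
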